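import Summits.CriticalPhenomena.PercolationContinuityZ3.Theorems.PercNearOneGluingNoHeavyLowerTailSunflowerCyclicStarLaw
import Mathlib.Tactic.LinearCombination
import Mathlib.Tactic.FinCases
import HarnessLib

/-!
# `NoHeavyLowerTail` (crux stmt-CriticalPhenomena-4575), abstract sunflower cubic: the EQUALITY LOCUS of (C1-law)
# `max(a,b)·(ab − e₂(c)) ≥ e₃(c)` on the cyclic-star law family, and Gladkov's inequality on the family

Support file (seat `prim-ineq-prove-1` gen 31; `--supports stmt-CriticalPhenomena-4575`).  Continuation of
`…SunflowerCyclicStarLaw` (p233015, gen 30), which replays cp-payer's exact certificate (run/shared/lean/ttrl/payer/cert/cert.json, sha256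
`495806b4a8d506c72ebce6ee431a502892938c2861855e7a97b7a243f1ab2fbe`; lane memo run/shared/lean/ttrl/payer/PAYER.md §5) for
`e₃(c) ≤ max(T,B)·AG` on the whole family of cyclic-star laws `CS(d₁,d₂,d₃)` in group-state weights `z q f ≥ 0`
(`CyclicStarLaw.e3_le_max_mul_AG`).  This file settles PAYER.md §5.4 (equality / strictness) exactly and removes the one hypothesis left
open in gen 30 (`hAG` in `e3_le_sum_mul_AG`):

* `AG_expand`, `AG_nonneg` — Gladkov's slack `AG = T·B − e₂(c)` EXPANDS to 29 monomials all with coefficient `+1`: Gladkov's inequality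
  holds on the whole family unconditionally (also at non-realisable weights); `e3_le_sum_mul_AG'` = the H-row without the `0 ≤ AG` hypothesis.
* `DT_eq_sq_mul_sub_prod`, `DB_eq_sq_mul_sub_prod` — `D_T = T²(T+B+e₁) − Π_l (T + c_l)`, `D_B = B²(T+B+e₁) − Π_l (B + c_l)`; at mass one
  Lemma A (law) reads `Π_l μ(U_l) ≤ μ(core)²` and Lemma B `Π_l μ(D_l) ≤ μ(bottom)²`, `D_l` = bottom ∪ petal `l` (`…_iff_of_mass_one`).
* FACES.  Every monomial of both certificate remainders `N_T`, `N_B` contains some `f_i` AND some `q_j`, so both vanish on the plain-star face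
  `f ≡ 0` and on the product face `q ≡ 0` (`NT_eq_zero_of_f`, `NT_eq_zero_of_q`, `NB_eq_zero_of_f`, `NB_eq_zero_of_q`); Lemma A is an
  IDENTITY on the plain-star face (`T_mul_AG_eq_e3_of_f`, i.e. `D_T ≡ 0`) and Lemma B an identity on the product face (`B_mul_AG_eq_e3_of_q`).
* STRICTNESS.  If there are rainbows (`0 < e₃`) and `N_T = 0` (or `N_B = 0`) then `f ≡ 0` or `q ≡ 0` (`f_or_q_eq_zero_of_NT_eq_zero`,
  `f_or_q_eq_zero_of_NB_eq_zero`): three witness monomials of each remainder (`WT_le_NT`, `WB_le_NB`: the cyclic orbits of `q₀³z₁f₁²z₂³`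
  and `q₀³z₁²f₁z₂³`) together with the positivity pattern forced by `e₃ > 0` leave no other zero.  No new definitions.
* SHARPNESS.  On the product face `D_T = λ_T(T−B)` exactly (`DT_eq_of_q`), so Lemma A holds there IFF `B ≤ T` (`e3_le_T_mul_AG_iff_of_q`);
  on the plain-star face `D_B = λ_B(B−T)` (`DB_eq_of_f`, `e3_le_B_mul_AG_iff_of_f`).  Hence no fixed convex combination of the two poles pays:
  `((T+B)/2)·AG ≥ e₃` fails at `z ≡ 2, q ≡ 0, f ≡ 1` (`half_sum_mul_AG_lt_e3_example`; cp-payer saw 493/4·10⁶ float failures).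
* `max_mul_AG_eq_e3_iff` — THE EQUALITY LOCUS: for `z q f ≥ 0` with `e₃ > 0`,
  `max(T,B)·AG = e₃  ⟺  (f ≡ 0 ∧ B ≤ T) ∨ (q ≡ 0 ∧ T ≤ B)`;
  `e3_lt_max_mul_AG` — strict as soon as some `f_i ≠ 0` and some `q_j ≠ 0`: inside the family (C1-law) is tight exactly on
  stars-with-heavier-kernel and products-with-heavier-bottom (PAYER.md §4's per-coordinate infimum `1` is a boundary effect).
-/

namespace Summit.CriticalPhenomena.PercolationContinuityZ3.Theorems.SunflowerPartition

namespace CyclicStarLaw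

open scoped NNReal

/-! ## Gladkov's slack has a positive expansion -/

/-- Gladkov's slack `AG = T·B − e₂(c)` fully expanded in the group-state weights: 29 monomials, every coefficient `+1`. [this work] -/
theorem AG_expand (z q f : Fin 3 → ℝ) : AG z q f =
    z 0 ^ 2 * z 1 * q 1 * z 2 * f 2 + z 0 ^ 2 * q 1 ^ 2 * z 2 * f 2 + z 0 ^ 2 * q 1 * f 1 * z 2 * f 2 +
    z 0 * q 0 * z 1 * q 1 * z 2 * q 2 + z 0 * q 0 * z 1 * q 1 * z 2 * f 2 + z 0 * q 0 * z 1 * f 1 * z 2 ^ 2 +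
    z 0 * q 0 * z 1 * f 1 * z 2 * q 2 + z 0 * q 0 * z 1 * f 1 * z 2 * f 2 + z 0 * q 0 * q 1 ^ 2 * z 2 * f 2 +
    z 0 * q 0 * q 1 * f 1 * z 2 * f 2 + z 0 * f 0 * z 1 ^ 2 * z 2 * q 2 + z 0 * f 0 * z 1 ^ 2 * q 2 ^ 2 +
    z 0 * f 0 * z 1 ^ 2 * q 2 * f 2 + z 0 * f 0 * z 1 * q 1 * z 2 * q 2 + z 0 * f 0 * z 1 * q 1 * z 2 * f 2 +
    z 0 * f 0 * z 1 * q 1 * q 2 ^ 2 + z 0 * f 0 * z 1 * q 1 * q 2 * f 2 + z 0 * f 0 * z 1 * f 1 * z 2 * q 2 +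
    z 0 * f 0 * z 1 * f 1 * z 2 * f 2 + z 0 * f 0 * z 1 * f 1 * q 2 ^ 2 + z 0 * f 0 * z 1 * f 1 * q 2 * f 2 +
    z 0 * f 0 * q 1 ^ 2 * z 2 * f 2 + z 0 * f 0 * q 1 * f 1 * z 2 * f 2 + q 0 ^ 2 * z 1 * f 1 * z 2 ^ 2 +
    q 0 ^ 2 * z 1 * f 1 * z 2 * q 2 + q 0 ^ 2 * z 1 * f 1 * z 2 * f 2 + q 0 * f 0 * z 1 * f 1 * z 2 ^ 2 +
    q 0 * f 0 * z 1 * f 1 * z 2 * q 2 + q 0 * f 0 * z 1 * f 1 * z 2 * f 2 := by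
  unfold AG T B c₁ c₂ c₃; ring

/-- **Gladkov's inequality on the cyclic-star law family**: `0 ≤ AG = T·B − e₂(c)` for all nonnegative group-state weights
(realisable or not). [this work] -/
theorem AG_nonneg (z q f : Fin 3 → ℝ) (hz : ∀ i, 0 ≤ z i) (hq : ∀ i, 0 ≤ q i) (hf : ∀ i, 0 ≤ f i) : 0 ≤ AG z q f := by
  rw [AG_expand]
  lift z to Fin 3 → ℝ≥0 using hz
  lift q to Fin 3 → ℝ≥0 using hq
  lift f to Fin 3 → ℝ≥0 using hf
  positivity

/-- The H-row `e₃ ≤ (T+B)·AG` on the family, now unconditional (gen 30's `e3_le_sum_mul_AG` took `0 ≤ AG` as a hypothesis). [this work] -/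
theorem e3_le_sum_mul_AG' (z q f : Fin 3 → ℝ) (hz : ∀ i, 0 ≤ z i) (hq : ∀ i, 0 ≤ q i) (hf : ∀ i, 0 ≤ f i) :
    e₃ z q f ≤ (T z q f + B z q f) * AG z q f :=
  e3_le_sum_mul_AG z q f hz hq hf (AG_nonneg z q f hz hq hf)

/-! ## Reformulations -/

/-- `D_T = T²·(T + B + e₁(c)) − (T + c₁)(T + c₂)(T + c₃)` (an abstract identity in `T, B, c`). [this work] -/
theorem DT_eq_sq_mul_sub_prod (z q f : Fin 3 → ℝ) :
    DT z q f = T z q f ^ 2 * (T z q f + B z q f + (c₁ z q f + c₂ z q f + c₃ z q f))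
      - (T z q f + c₁ z q f) * (T z q f + c₂ z q f) * (T z q f + c₃ z q f) := by
  unfold DT AG e₃; ring

/-- `D_B = B²·(T + B + e₁(c)) − (B + c₁)(B + c₂)(B + c₃)`. [this work] -/
theorem DB_eq_sq_mul_sub_prod (z q f : Fin 3 → ℝ) :
    DB z q f = B z q f ^ 2 * (T z q f + B z q f + (c₁ z q f + c₂ z q f + c₃ z q f))
      - (B z q f + c₁ z q f) * (B z q f + c₂ z q f) * (B z q f + c₃ z q f) := by
  unfold DB AG e₃; ring

/-- At total mass one, `D_T = T² − Π_l (T + c_l)`. [this work] -/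
theorem DT_eq_of_mass_one (z q f : Fin 3 → ℝ) (h : (z 0 + q 0 + f 0) * (z 1 + q 1 + f 1) * (z 2 + q 2 + f 2) = 1) :
    DT z q f = T z q f ^ 2 - (T z q f + c₁ z q f) * (T z q f + c₂ z q f) * (T z q f + c₃ z q f) := by
  rw [DT_eq_sq_mul_sub_prod]
  linear_combination (T z q f ^ 2) * (sum_cells z q f) + (T z q f ^ 2) * h

/-- At total mass one, `D_B = B² − Π_l (B + c_l)`. [this work] -/
theorem DB_eq_of_mass_one (z q f : Fin 3 → ℝ) (h : (z 0 + q 0 + f 0) * (z 1 + q 1 + f 1) * (z 2 + q 2 + f 2) = 1) :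
    DB z q f = B z q f ^ 2 - (B z q f + c₁ z q f) * (B z q f + c₂ z q f) * (B z q f + c₃ z q f) := by
  rw [DB_eq_sq_mul_sub_prod]
  linear_combination (B z q f ^ 2) * (sum_cells z q f) + (B z q f ^ 2) * h

/-- Lemma A (law) at mass one ⟺ `Π_l μ(U_l) ≤ μ(core)²` (`μ(U_l) = T + c_l`, `μ(core) = T`). [this work] -/
theorem e3_le_T_mul_AG_iff_of_mass_one (z q f : Fin 3 → ℝ)
    (h : (z 0 + q 0 + f 0) * (z 1 + q 1 + f 1) * (z 2 + q 2 + f 2) = 1) :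
    e₃ z q f ≤ T z q f * AG z q f ↔
      (T z q f + c₁ z q f) * (T z q f + c₂ z q f) * (T z q f + c₃ z q f) ≤ T z q f ^ 2 := by
  have h1 := DT_eq_of_mass_one z q f h
  unfold DT at h1
  constructor <;> intro h2 <;> linarith

/-- Lemma B (law) at mass one ⟺ `Π_l μ(D_l) ≤ μ(bottom)²` (`μ(D_l) = B + c_l`, `D_l` = bottom ∪ petal `l`). [this work] -/
theorem e3_le_B_mul_AG_iff_of_mass_one (z q f : Fin 3 → ℝ)
    (h : (z 0 + q 0 + f 0) * (z 1 + q 1 + f 1) * (z 2 + q 2 + f 2) = 1) :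
    e₃ z q f ≤ B z q f * AG z q f ↔
      (B z q f + c₁ z q f) * (B z q f + c₂ z q f) * (B z q f + c₃ z q f) ≤ B z q f ^ 2 := by
  have h1 := DB_eq_of_mass_one z q f h
  unfold DB at h1
  constructor <;> intro h2 <;> linarith

/-! ## The two equality faces -/

/-- `N_T` vanishes on the plain-star face `f ≡ 0` (every monomial of `N_T` contains some `f_i`). [this work] -/
theorem NT_eq_zero_of_f (z q f : Fin 3 → ℝ) (h : ∀ i, f i = 0) : NT z q f = 0 := by
  simp [NT, NT1, NT2, NT3, NT4, NT5, NT6, NT7, NT8, h]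

/-- `N_T` vanishes on the product face `q ≡ 0` (every monomial of `N_T` contains some `q_j`). [this work] -/
theorem NT_eq_zero_of_q (z q f : Fin 3 → ℝ) (h : ∀ i, q i = 0) : NT z q f = 0 := by
  simp [NT, NT1, NT2, NT3, NT4, NT5, NT6, NT7, NT8, h]

/-- `N_B` vanishes on the plain-star face `f ≡ 0`. [this work] -/
theorem NB_eq_zero_of_f (z q f : Fin 3 → ℝ) (h : ∀ i, f i = 0) : NB z q f = 0 := by
  simp [NB, NB1, NB2, NB3, h]

/-- `N_B` vanishes on the product face `q ≡ 0`. [this work] -/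
theorem NB_eq_zero_of_q (z q f : Fin 3 → ℝ) (h : ∀ i, q i = 0) : NB z q f = 0 := by
  simp [NB, NB1, NB2, NB3, h]

/-- Lemma A is an IDENTITY on the plain-star face: `f ≡ 0 ⇒ T·AG = e₃` (`D_T ≡ 0`). [this work] -/
theorem T_mul_AG_eq_e3_of_f (z q f : Fin 3 → ℝ) (h : ∀ i, f i = 0) : T z q f * AG z q f = e₃ z q f := by
  have h1 := DT_eq z q f
  rw [NT_eq_zero_of_f z q f h, h 0] at h1
  simp only [mul_zero, zero_mul, add_zero] at h1
  unfold DT at h1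
  linarith

/-- Lemma B is an IDENTITY on the product face: `q ≡ 0 ⇒ B·AG = e₃` (`D_B ≡ 0`). [this work] -/
theorem B_mul_AG_eq_e3_of_q (z q f : Fin 3 → ℝ) (h : ∀ i, q i = 0) : B z q f * AG z q f = e₃ z q f := by
  have h1 := DB_eq z q f
  rw [NB_eq_zero_of_q z q f h, h 0] at h1
  simp only [mul_zero, zero_mul, add_zero] at h1
  unfold DB at h1
  linarith

/-- On the product face the Lemma-A slack is EXACTLY `λ_T·(T − B)`: `q ≡ 0 ⇒ D_T = z₀z₁z₂f₀f₁f₂(T − B)`. [this work] -/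
theorem DT_eq_of_q (z q f : Fin 3 → ℝ) (h : ∀ i, q i = 0) :
    DT z q f = z 0 * z 1 * z 2 * f 0 * f 1 * f 2 * (T z q f - B z q f) := by
  rw [DT_eq, NT_eq_zero_of_q z q f h, add_zero]

/-- On the plain-star face the Lemma-B slack is EXACTLY `λ_B·(B − T)`: `f ≡ 0 ⇒ D_B = z₀z₁z₂q₀q₁q₂(B − T)`. [this work] -/
theorem DB_eq_of_f (z q f : Fin 3 → ℝ) (h : ∀ i, f i = 0) :
    DB z q f = z 0 * z 1 * z 2 * q 0 * q 1 * q 2 * (B z q f - T z q f) := by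
  rw [DB_eq, NB_eq_zero_of_f z q f h, add_zero]

/-! ## What `e₃ > 0` forces -/

/-- `e₃ = c₁c₂c₃ > 0` forces every petal mass to be nonzero. [this work] -/
theorem c_ne_zero_of_e3_pos (z q f : Fin 3 → ℝ) (he : 0 < e₃ z q f) :
    c₁ z q f ≠ 0 ∧ c₂ z q f ≠ 0 ∧ c₃ z q f ≠ 0 := by
  refine ⟨?_, ?_, ?_⟩ <;> intro h <;> simp [e₃, h] at he

/-- `e₃ > 0` forces every "miss" weight `z_i` to be nonzero (petal `l` needs group `l−1` missed). [this work] -/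
theorem z_ne_zero_of_e3_pos (z q f : Fin 3 → ℝ) (he : 0 < e₃ z q f) : z 0 ≠ 0 ∧ z 1 ≠ 0 ∧ z 2 ≠ 0 := by
  obtain ⟨h1, h2, h3⟩ := c_ne_zero_of_e3_pos z q f he
  refine ⟨?_, ?_, ?_⟩
  · intro h; apply h1; simp [c₁, h]
  · intro h; apply h2; simp [c₂, h]
  · intro h; apply h3; simp [c₃, h]

/-- `e₃ > 0` forces, for each group, "full weight nonzero, or both neighbouring partial weights nonzero". [this work] -/
theorem fq_pattern_of_e3_pos (z q f : Fin 3 → ℝ) (he : 0 < e₃ z q f) :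
    (f 1 ≠ 0 ∨ (q 1 ≠ 0 ∧ q 2 ≠ 0)) ∧ (f 2 ≠ 0 ∨ (q 0 ≠ 0 ∧ q 2 ≠ 0)) ∧ (f 0 ≠ 0 ∨ (q 0 ≠ 0 ∧ q 1 ≠ 0)) := by
  obtain ⟨h1, h2, h3⟩ := c_ne_zero_of_e3_pos z q f he
  refine ⟨?_, ?_, ?_⟩
  · by_contra hc; push Not at hc; obtain ⟨ha, hb⟩ := hc; apply h1
    by_cases hq1 : q 1 = 0
    · simp [c₁, ha, hq1]
    · simp [c₁, ha, hb hq1]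
  · by_contra hc; push Not at hc; obtain ⟨ha, hb⟩ := hc; apply h2
    by_cases hq0 : q 0 = 0
    · simp [c₂, ha, hq0]
    · simp [c₂, ha, hb hq0]
  · by_contra hc; push Not at hc; obtain ⟨ha, hb⟩ := hc; apply h3
    by_cases hq0 : q 0 = 0
    · simp [c₃, ha, hq0]
    · simp [c₃, ha, hb hq0]

/-- On the product face with rainbows, all miss and full weights are positive: `λ_T = z₀z₁z₂f₀f₁f₂ > 0`. [this work] -/
theorem lambdaT_pos_of_q (z q f : Fin 3 → ℝ) (hz : ∀ i, 0 ≤ z i) (hf : ∀ i, 0 ≤ f i)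
    (he : 0 < e₃ z q f) (hQ : ∀ i, q i = 0) : 0 < z 0 * z 1 * z 2 * f 0 * f 1 * f 2 := by
  obtain ⟨h1, h2, h3⟩ := c_ne_zero_of_e3_pos z q f he
  simp only [c₁, c₂, c₃, hQ, mul_zero, zero_mul, add_zero, zero_add, ne_eq, mul_eq_zero, not_or] at h1 h2 h3
  have p0 : 0 < z 0 := lt_of_le_of_ne (hz 0) (Ne.symm h1.1.1); have p1 : 0 < f 1 := lt_of_le_of_ne (hf 1) (Ne.symm h1.1.2)
  have p2 : 0 < z 2 := lt_of_le_of_ne (hz 2) (Ne.symm h1.2); have p3 : 0 < z 1 := lt_of_le_of_ne (hz 1) (Ne.symm h2.1.2)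
  have p4 : 0 < f 2 := lt_of_le_of_ne (hf 2) (Ne.symm h2.2); have p5 : 0 < f 0 := lt_of_le_of_ne (hf 0) (Ne.symm h3.1.1)
  positivity

/-- On the plain-star face with rainbows, all miss and partial weights are positive: `λ_B = z₀z₁z₂q₀q₁q₂ > 0`. [this work] -/
theorem lambdaB_pos_of_f (z q f : Fin 3 → ℝ) (hz : ∀ i, 0 ≤ z i) (hq : ∀ i, 0 ≤ q i)
    (he : 0 < e₃ z q f) (hF : ∀ i, f i = 0) : 0 < z 0 * z 1 * z 2 * q 0 * q 1 * q 2 := by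
  obtain ⟨h1, h2, h3⟩ := c_ne_zero_of_e3_pos z q f he
  simp only [c₁, c₂, c₃, hF, mul_zero, zero_mul, add_zero, zero_add, ne_eq, mul_eq_zero, not_or] at h1 h2 h3
  have p0 : 0 < z 0 := lt_of_le_of_ne (hz 0) (Ne.symm h1.1.1); have p1 : 0 < q 1 := lt_of_le_of_ne (hq 1) (Ne.symm h1.1.2)
  have p2 : 0 < q 2 := lt_of_le_of_ne (hq 2) (Ne.symm h1.2); have p3 : 0 < q 0 := lt_of_le_of_ne (hq 0) (Ne.symm h2.1.1)
  have p4 : 0 < z 1 := lt_of_le_of_ne (hz 1) (Ne.symm h2.1.2); have p5 : 0 < z 2 := lt_of_le_of_ne (hz 2) (Ne.symm h3.2)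
  positivity

/-! ## Witness monomials of the remainders and the strictness lemma -/

set_option maxRecDepth 4000 in
-- `ring_nf` on the 202-monomial remainder needs a deeper recursion budget (term depth), nothing else is raised.
/-- WITNESSES of `N_T`: the three monomials `W_T` = cyclic orbit of `q₀³ z₁ f₁² z₂³` are monomials of cert.json's `N_T` (coefficient 1),
so `W_T ≤ N_T` on the orthant (`N_T − W_T` still has nonnegative coefficients). [this work] -/
theorem WT_le_NT (z q f : Fin 3 → ℝ) (hz : ∀ i, 0 ≤ z i) (hq : ∀ i, 0 ≤ q i) (hf : ∀ i, 0 ≤ f i) :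
    q 0 ^ 3 * z 1 * f 1 ^ 2 * z 2 ^ 3 + q 2 ^ 3 * z 0 * f 0 ^ 2 * z 1 ^ 3 + q 1 ^ 3 * z 2 * f 2 ^ 2 * z 0 ^ 3 ≤ NT z q f := by
  lift z to Fin 3 → ℝ≥0 using hz
  lift q to Fin 3 → ℝ≥0 using hq
  lift f to Fin 3 → ℝ≥0 using hf
  rw [← sub_nonneg]
  unfold NT NT1 NT2 NT3 NT4 NT5 NT6 NT7 NT8
  ring_nf
  positivity

/-- WITNESSES of `N_B`: the cyclic orbit `W_B` of `q₀³ z₁² f₁ z₂³` consists of monomials of `N_B`, so `W_B ≤ N_B` on the orthant. [this work] -/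
theorem WB_le_NB (z q f : Fin 3 → ℝ) (hz : ∀ i, 0 ≤ z i) (hq : ∀ i, 0 ≤ q i) (hf : ∀ i, 0 ≤ f i) :
    q 0 ^ 3 * z 1 ^ 2 * f 1 * z 2 ^ 3 + q 2 ^ 3 * z 0 ^ 2 * f 0 * z 1 ^ 3 + q 1 ^ 3 * z 2 ^ 2 * f 2 * z 0 ^ 3 ≤ NB z q f := by
  lift z to Fin 3 → ℝ≥0 using hz
  lift q to Fin 3 → ℝ≥0 using hq
  lift f to Fin 3 → ℝ≥0 using hf
  rw [← sub_nonneg]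
  unfold NB NB1 NB2 NB3
  ring_nf
  positivity

/-- A witness monomial of shape `a³ b cᵏ d³` with `b, d ≠ 0` vanishes only if `a = 0` or `c = 0`. [this work] -/
theorem eq_zero_or_of_witness {a b c d : ℝ} {j k : ℕ} (hb : b ≠ 0) (hd : d ≠ 0) (hk : k ≠ 0) (hj : j ≠ 0)
    (h : a ^ 3 * b ^ j * c ^ k * d ^ 3 = 0) : a = 0 ∨ c = 0 := by
  simp only [mul_eq_zero, pow_eq_zero_iff (by norm_num : (3:ℕ) ≠ 0), pow_eq_zero_iff hk, pow_eq_zero_iff hj, hb, hd,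
    or_false] at h
  exact h

/-- The propositional core of the strictness argument: the positivity pattern forced by `e₃ > 0` and the vanishing of the three
witnesses leave only the two faces. [this work] -/
theorem faces_of_pattern {q f : Fin 3 → ℝ}
    (A1 : f 1 ≠ 0 ∨ (q 1 ≠ 0 ∧ q 2 ≠ 0)) (A2 : f 2 ≠ 0 ∨ (q 0 ≠ 0 ∧ q 2 ≠ 0)) (A3 : f 0 ≠ 0 ∨ (q 0 ≠ 0 ∧ q 1 ≠ 0))
    (W1 : q 0 = 0 ∨ f 1 = 0) (W2 : q 2 = 0 ∨ f 0 = 0) (W3 : q 1 = 0 ∨ f 2 = 0) :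
    (∀ i, f i = 0) ∨ (∀ i, q i = 0) := by
  rcases eq_or_ne (f 0) 0 with hf0 | hf0
  · have hq01 : q 0 ≠ 0 ∧ q 1 ≠ 0 := A3.resolve_left (not_not.mpr hf0)
    have hf1 : f 1 = 0 := W1.resolve_left hq01.1
    have hf2 : f 2 = 0 := W3.resolve_left hq01.2
    exact Or.inl fun i => by fin_cases i <;> assumption
  · have hq2 : q 2 = 0 := W2.resolve_right hf0
    have hf2 : f 2 ≠ 0 := A2.resolve_right (fun h => h.2 hq2)
    have hq1 : q 1 = 0 := W3.resolve_right hf2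
    have hf1 : f 1 ≠ 0 := A1.resolve_right (fun h => h.1 hq1)
    have hq0 : q 0 = 0 := W1.resolve_right hf1
    exact Or.inr fun i => by fin_cases i <;> assumption

/-- STRICTNESS LEMMA for Lemma A's remainder: with rainbows present, `N_T = 0` only on the two faces. [this work] -/
theorem f_or_q_eq_zero_of_NT_eq_zero (z q f : Fin 3 → ℝ) (hz : ∀ i, 0 ≤ z i) (hq : ∀ i, 0 ≤ q i) (hf : ∀ i, 0 ≤ f i)
    (he : 0 < e₃ z q f) (hN : NT z q f = 0) : (∀ i, f i = 0) ∨ (∀ i, q i = 0) := by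
  obtain ⟨hz0, hz1, hz2⟩ := z_ne_zero_of_e3_pos z q f he
  obtain ⟨A1, A2, A3⟩ := fq_pattern_of_e3_pos z q f he
  have hW := WT_le_NT z q f hz hq hf
  rw [hN] at hW
  have hz0' := hz 0; have hz1' := hz 1; have hz2' := hz 2
  have hq0' := hq 0; have hq1' := hq 1; have hq2' := hq 2
  have hf0' := hf 0; have hf1' := hf 1; have hf2' := hf 2
  have m1 : 0 ≤ q 0 ^ 3 * z 1 * f 1 ^ 2 * z 2 ^ 3 := by positivity
  have m2 : 0 ≤ q 2 ^ 3 * z 0 * f 0 ^ 2 * z 1 ^ 3 := by positivity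
  have m3 : 0 ≤ q 1 ^ 3 * z 2 * f 2 ^ 2 * z 0 ^ 3 := by positivity
  have e1 : q 0 ^ 3 * z 1 ^ 1 * f 1 ^ 2 * z 2 ^ 3 = 0 := by rw [pow_one]; linarith
  have e2 : q 2 ^ 3 * z 0 ^ 1 * f 0 ^ 2 * z 1 ^ 3 = 0 := by rw [pow_one]; linarith
  have e3 : q 1 ^ 3 * z 2 ^ 1 * f 2 ^ 2 * z 0 ^ 3 = 0 := by rw [pow_one]; linarith
  exact faces_of_pattern A1 A2 A3 (eq_zero_or_of_witness hz1 hz2 (by norm_num) (by norm_num) e1)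
    (eq_zero_or_of_witness hz0 hz1 (by norm_num) (by norm_num) e2) (eq_zero_or_of_witness hz2 hz0 (by norm_num) (by norm_num) e3)

/-- STRICTNESS LEMMA for Lemma B's remainder: with rainbows present, `N_B = 0` only on the two faces. [this work] -/
theorem f_or_q_eq_zero_of_NB_eq_zero (z q f : Fin 3 → ℝ) (hz : ∀ i, 0 ≤ z i) (hq : ∀ i, 0 ≤ q i) (hf : ∀ i, 0 ≤ f i)
    (he : 0 < e₃ z q f) (hN : NB z q f = 0) : (∀ i, f i = 0) ∨ (∀ i, q i = 0) := by
  obtain ⟨hz0, hz1, hz2⟩ := z_ne_zero_of_e3_pos z q f he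
  obtain ⟨A1, A2, A3⟩ := fq_pattern_of_e3_pos z q f he
  have hW := WB_le_NB z q f hz hq hf
  rw [hN] at hW
  have hz0' := hz 0; have hz1' := hz 1; have hz2' := hz 2
  have hq0' := hq 0; have hq1' := hq 1; have hq2' := hq 2
  have hf0' := hf 0; have hf1' := hf 1; have hf2' := hf 2
  have m1 : 0 ≤ q 0 ^ 3 * z 1 ^ 2 * f 1 * z 2 ^ 3 := by positivity
  have m2 : 0 ≤ q 2 ^ 3 * z 0 ^ 2 * f 0 * z 1 ^ 3 := by positivity
  have m3 : 0 ≤ q 1 ^ 3 * z 2 ^ 2 * f 2 * z 0 ^ 3 := by positivity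
  have e1 : q 0 ^ 3 * z 1 ^ 2 * f 1 ^ 1 * z 2 ^ 3 = 0 := by rw [pow_one]; linarith
  have e2 : q 2 ^ 3 * z 0 ^ 2 * f 0 ^ 1 * z 1 ^ 3 = 0 := by rw [pow_one]; linarith
  have e3 : q 1 ^ 3 * z 2 ^ 2 * f 2 ^ 1 * z 0 ^ 3 = 0 := by rw [pow_one]; linarith
  exact faces_of_pattern A1 A2 A3 (eq_zero_or_of_witness hz1 hz2 (by norm_num) (by norm_num) e1)
    (eq_zero_or_of_witness hz0 hz1 (by norm_num) (by norm_num) e2) (eq_zero_or_of_witness hz2 hz0 (by norm_num) (by norm_num) e3)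

/-! ## The equality locus -/

/-- **EQUALITY LOCUS of (C1-law) on the cyclic-star law family** (PAYER.md §5.4, made exact): for nonnegative group-state weights with
rainbows present (`e₃ > 0`), `max(T,B)·AG = e₃` holds iff EITHER all full weights vanish (plain-star face, Lemma A an identity) and the
kernel is at least the bottom, OR all partial weights vanish (product face, Lemma B an identity) and the bottom is at least the kernel.
[this work] -/
theorem max_mul_AG_eq_e3_iff (z q f : Fin 3 → ℝ) (hz : ∀ i, 0 ≤ z i) (hq : ∀ i, 0 ≤ q i) (hf : ∀ i, 0 ≤ f i)
    (he : 0 < e₃ z q f) :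
    max (T z q f) (B z q f) * AG z q f = e₃ z q f ↔
      ((∀ i, f i = 0) ∧ B z q f ≤ T z q f) ∨ ((∀ i, q i = 0) ∧ T z q f ≤ B z q f) := by
  constructor
  · intro h
    rcases le_total (B z q f) (T z q f) with hBT | hTB
    · rw [max_eq_left hBT] at h
      have hId := DT_eq z q f
      have hN := NT_nonneg z q f hz hq hf
      have hL : 0 ≤ z 0 * z 1 * z 2 * f 0 * f 1 * f 2 * (T z q f - B z q f) := mul_nonneg (mul_nonneg (mul_nonneg
        (mul_nonneg (mul_nonneg (mul_nonneg (hz 0) (hz 1)) (hz 2)) (hf 0)) (hf 1)) (hf 2)) (sub_nonneg.mpr hBT)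
      unfold DT at hId
      have hN0 : NT z q f = 0 := by linarith
      rcases f_or_q_eq_zero_of_NT_eq_zero z q f hz hq hf he hN0 with hF | hQ
      · exact Or.inl ⟨hF, hBT⟩
      · refine Or.inr ⟨hQ, ?_⟩
        have hL0 : z 0 * z 1 * z 2 * f 0 * f 1 * f 2 * (T z q f - B z q f) = 0 := by linarith
        have hpos := lambdaT_pos_of_q z q f hz hf he hQ
        rcases mul_eq_zero.1 hL0 with h0 | h0
        · exact absurd h0 hpos.ne'
        · linarith
    · rw [max_eq_right hTB] at h
      have hId := DB_eq z q f
      have hN := NB_nonneg z q f hz hq hf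
      have hL : 0 ≤ z 0 * z 1 * z 2 * q 0 * q 1 * q 2 * (B z q f - T z q f) := mul_nonneg (mul_nonneg (mul_nonneg
        (mul_nonneg (mul_nonneg (mul_nonneg (hz 0) (hz 1)) (hz 2)) (hq 0)) (hq 1)) (hq 2)) (sub_nonneg.mpr hTB)
      unfold DB at hId
      have hN0 : NB z q f = 0 := by linarith
      rcases f_or_q_eq_zero_of_NB_eq_zero z q f hz hq hf he hN0 with hF | hQ
      · refine Or.inl ⟨hF, ?_⟩
        have hL0 : z 0 * z 1 * z 2 * q 0 * q 1 * q 2 * (B z q f - T z q f) = 0 := by linarith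
        have hpos := lambdaB_pos_of_f z q f hz hq he hF
        rcases mul_eq_zero.1 hL0 with h0 | h0
        · exact absurd h0 hpos.ne'
        · linarith
      · exact Or.inr ⟨hQ, hTB⟩
  · rintro (⟨hF, hBT⟩ | ⟨hQ, hTB⟩)
    · rw [max_eq_left hBT]; exact T_mul_AG_eq_e3_of_f z q f hF
    · rw [max_eq_right hTB]; exact B_mul_AG_eq_e3_of_q z q f hQ

/-- **STRICT (C1-law) off the two faces**: if rainbows are present and some full weight and some partial weight are nonzero, then
`e₃ < max(T,B)·AG`. [this work] -/
theorem e3_lt_max_mul_AG (z q f : Fin 3 → ℝ) (hz : ∀ i, 0 ≤ z i) (hq : ∀ i, 0 ≤ q i) (hf : ∀ i, 0 ≤ f i)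
    (he : 0 < e₃ z q f) (hF : ∃ i, f i ≠ 0) (hQ : ∃ i, q i ≠ 0) :
    e₃ z q f < max (T z q f) (B z q f) * AG z q f := by
  refine lt_of_le_of_ne (e3_le_max_mul_AG z q f hz hq hf) (fun h => ?_)
  rcases (max_mul_AG_eq_e3_iff z q f hz hq hf he).1 h.symm with ⟨hF', _⟩ | ⟨hQ', _⟩
  · obtain ⟨i, hi⟩ := hF; exact hi (hF' i)
  · obtain ⟨i, hi⟩ := hQ; exact hi (hQ' i)

/-! ## The hypothesis `max` is sharp: facewise characterisation and failure of the convex version -/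

/-- SHARPNESS on the product face: with rainbows present and `q ≡ 0`, Lemma A holds IFF the kernel is at least the bottom. [this work] -/
theorem e3_le_T_mul_AG_iff_of_q (z q f : Fin 3 → ℝ) (hz : ∀ i, 0 ≤ z i) (hf : ∀ i, 0 ≤ f i)
    (he : 0 < e₃ z q f) (hQ : ∀ i, q i = 0) : e₃ z q f ≤ T z q f * AG z q f ↔ B z q f ≤ T z q f := by
  have h1 := DT_eq_of_q z q f hQ
  unfold DT at h1
  have hpos := lambdaT_pos_of_q z q f hz hf he hQ
  constructor
  · intro h; by_contra hlt; push Not at hlt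
    have : z 0 * z 1 * z 2 * f 0 * f 1 * f 2 * (T z q f - B z q f) < 0 := mul_neg_of_pos_of_neg hpos (by linarith)
    linarith
  · intro h
    have : 0 ≤ z 0 * z 1 * z 2 * f 0 * f 1 * f 2 * (T z q f - B z q f) := mul_nonneg hpos.le (by linarith)
    linarith

/-- SHARPNESS on the plain-star face: with rainbows present and `f ≡ 0`, Lemma B holds IFF the bottom is at least the kernel. [this work] -/
theorem e3_le_B_mul_AG_iff_of_f (z q f : Fin 3 → ℝ) (hz : ∀ i, 0 ≤ z i) (hq : ∀ i, 0 ≤ q i)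
    (he : 0 < e₃ z q f) (hF : ∀ i, f i = 0) : e₃ z q f ≤ B z q f * AG z q f ↔ T z q f ≤ B z q f := by
  have h1 := DB_eq_of_f z q f hF
  unfold DB at h1
  have hpos := lambdaB_pos_of_f z q f hz hq he hF
  constructor
  · intro h; by_contra hlt; push Not at hlt
    have : z 0 * z 1 * z 2 * q 0 * q 1 * q 2 * (B z q f - T z q f) < 0 := mul_neg_of_pos_of_neg hpos (by linarith)
    linarith
  · intro h
    have : 0 ≤ z 0 * z 1 * z 2 * q 0 * q 1 * q 2 * (B z q f - T z q f) := mul_nonneg hpos.le (by linarith)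
    linarith

/-- The CONVEX version `((T+B)/2)·AG ≥ e₃` is FALSE (cp-payer: 493 of 4·10⁶ samples); exact witness on the product face with bottom heavier
than kernel: `z ≡ 2, q ≡ 0, f ≡ 1` gives `T = 7, B = 8, c ≡ 4, AG = 8, e₃ = 64 > 60 = (15/2)·8`. [this work] -/
theorem half_sum_mul_AG_lt_e3_example :
    (T (fun _ => 2) (fun _ => 0) (fun _ => 1) + B (fun _ => 2) (fun _ => 0) (fun _ => 1)) / 2 *
        AG (fun _ => 2) (fun _ => 0) (fun _ => 1) < e₃ (fun _ => 2) (fun _ => 0) (fun _ => 1) := by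
  norm_num [T, B, AG, e₃, c₁, c₂, c₃]

end CyclicStarLaw

end Summit.CriticalPhenomena.PercolationContinuityZ3.Theorems.SunflowerPartition
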